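import Summits.AtomisticToContinuum.Crystallization.Theses.PalmUnimodularRigidity
import Literature.Geometry.DiscreteGeometry.LayerShellPatterns
import Literature.MathematicalPhysics.StatisticalMechanics.BarlowRings

/-!
# `ShellsToBarlowChart` (stmt-AtomisticToContinuum-9227), negative side I: the scale-window parametrisation and calibration

Negative-side lemmas of the crux disprover (`Cruxes/ShellsToBarlowChart/Disproof.lean`, cycle 1),
part I (part II, `ScaleWindow.lean`, holds the load-bearing lemmas that use these witnesses):

* the crux parametrised by its scale window, `ShellsToBarlowChartScaled lo hi` (per-point
  hypothesis `GoodShellAt lo hi S x`, conclusion `BarlowChart S`), with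
  `ShellsToBarlowChart ↔ ShellsToBarlowChartScaled (9/10) 1` by `Iff.rfl`;
* scaling of Barlow stackings (`smul_barlowPos`, `smul_mem_barlowStacking_iff`);
* CALIBRATION (`goodShell_barlowStacking`, `hypothesis_barlowStacking`): every ideal Barlow stacking
  `barlowStacking c (c√(2/3)) s` (`s` Hägg, `c > 0`) has, within radius `5c/4` of each point,
  exactly its twelve touching offsets (distance gap `(c, √2 c)`), arranged EXACTLY in the
  `c`-scaled FCC or HCP pattern (Hales's normalisation `c = 2` rescaled) — so the hypothesis of
  the crux holds for all of them at every scale `c ∈ [9/10, 1]`: the hypothesis class is far from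
  vacuous (uncountably many congruence classes), and no junk-model exit exists.

All `[folklore]`; inputs: `BarlowRings.dist_eq_of_dist_le_of_lt`,
`LayerShellPatterns.hasFccOrHcpShells_barlowStacking'`.
-/

noncomputable section

namespace Summit.AtomisticToContinuum.Crystallization.Theorems.ShellsToBarlowChartNegative

open Literature.Geometry.DiscreteGeometry Literature.MathematicalPhysics.StatisticalMechanics
open Summit.AtomisticToContinuum.Crystallization.Theses.PalmUnimodularRigidity

/-- Euclidean `3`-space. [folklore] -/
local notation "E3" => EuclideanSpace ℝ (Fin 3)

/-! ## The crux, parametrised by its scale window -/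

/-- The per-point hypothesis of the crux at `x ∈ S`, with the scale window `[lo, hi]` as a
parameter (the crux has `lo = 9/10`, `hi = 1`). [folklore] -/
def GoodShellAt (lo hi : ℝ) (S : Set E3) (x : E3) : Prop :=
  ∃ a : ℝ, lo ≤ a ∧ a ≤ hi ∧ ∃ T : Finset E3,
    (↑T : Set E3) = (fun y : E3 => y - x) '' {y : E3 | y ∈ S ∧ y ≠ x ∧ dist y x ≤ 5 / 4 * a} ∧
    (ShellCloseTo (a / 100) T (Finset.image (fun v : E3 => a • v) fccKissingPattern) ∨
      ShellCloseTo (a / 100) T (Finset.image (fun v : E3 => a • v) hcpKissingPattern))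

/-- The conclusion of the crux for `S`: a global bond-isomorphism with an ideal Barlow stacking. [folklore] -/
def BarlowChart (S : Set E3) : Prop :=
  ∃ s : ℤ → ℤ, IsHaggSeq s ∧ ∃ Φ : E3 → E3,
    Set.BijOn Φ (barlowStacking 1 (Real.sqrt (2 / 3)) s) S ∧
    ∀ p ∈ barlowStacking 1 (Real.sqrt (2 / 3)) s, ∀ q ∈ barlowStacking 1 (Real.sqrt (2 / 3)) s,
      (dist p q = 1 ↔ (0 < dist (Φ p) (Φ q) ∧ dist (Φ p) (Φ q) ≤ 28 / 25))

/-- The crux with scale window `[lo, hi]`. [folklore] -/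
def ShellsToBarlowChartScaled (lo hi : ℝ) : Prop :=
  ∀ S : Set E3, S.Nonempty → (∀ x ∈ S, GoodShellAt lo hi S x) → BarlowChart S

/-- The crux IS the window `[9/10, 1]` instance (definitional). [folklore] -/
theorem shellsToBarlowChart_iff_scaled :
    ShellsToBarlowChart ↔ ShellsToBarlowChartScaled (9 / 10) 1 := Iff.rfl

/-! ## Scaling of Barlow stackings -/

/-- `t • barlowPos a h s k i j = barlowPos (t a) (t h) s k i j`. [folklore] -/
theorem smul_barlowPos (t a h : ℝ) (s : ℤ → ℤ) (k i j : ℤ) :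
    t • barlowPos a h s k i j = barlowPos (t * a) (t * h) s k i j := by
  ext l
  fin_cases l <;> simp <;> ring

/-- Scaling a Barlow stacking scales its two spacings. [folklore] -/
theorem smul_mem_barlowStacking_iff {t a h : ℝ} (ht : t ≠ 0) {s : ℤ → ℤ} {x : E3} :
    t • x ∈ barlowStacking (t * a) (t * h) s ↔ x ∈ barlowStacking a h s := by
  constructor
  · rintro ⟨k, i, j, hk⟩
    refine ⟨k, i, j, ?_⟩
    have : t • x = t • barlowPos a h s k i j := by rw [hk, smul_barlowPos]
    exact smul_right_injective _ ht this
  · rintro ⟨k, i, j, rfl⟩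
    exact ⟨k, i, j, smul_barlowPos t a h s k i j⟩


/-! ## Calibration: ideal Barlow stackings have good shells at their own scale

For every Hägg sequence `s` and every scale `c > 0`, every point of the ideal stacking
`barlowStacking c (c√(2/3)) s` has, within radius `5c/4`, exactly its twelve touching neighbours
(distance gap `(c, √2 c)`, `BarlowRings.lean`), arranged EXACTLY (tolerance `0 ≤ c/100`) in the
`c`-scaled FCC or HCP pattern (`LayerShellPatterns.hasFccOrHcpShells_barlowStacking'`, rescaled
from Hales's normalisation `c = 2`).  Consequences: (i) the hypothesis class of the crux is far from
vacuous (every ideal stacking at every scale in `[9/10, 1]`, uncountably many congruence classes);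
(ii) the same stackings at the WRONG scale are the witnesses of the load-bearing lemmas below. -/

section Calibration

variable {s : ℤ → ℤ}

/-- The ideal spacing relation `h² = ⅔ c²` for `h = c √(2/3)`. [folklore] -/
theorem ideal_sq (c : ℝ) : (c * Real.sqrt (2 / 3)) ^ 2 = 2 / 3 * c ^ 2 := by
  rw [mul_pow, Real.sq_sqrt (by norm_num)]; ring

/-- `5/4 < √2`: the shell radius `5c/4` stays below the second coordination shell `√2 c`.
[folklore] -/
theorem five_fourths_lt_sqrt_two : (5 / 4 : ℝ) < Real.sqrt 2 := by
  rw [show (5 / 4 : ℝ) = Real.sqrt ((5 / 4) ^ 2) by rw [Real.sqrt_sq]; norm_num]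
  exact Real.sqrt_lt_sqrt (by norm_num) (by norm_num)

/-- **Within radius `5c/4` a point of the ideal stacking sees exactly its touching offsets.**
[cite: HalesDSP2012, §1.3] -/
theorem shellSet_eq (hs : IsHaggSeq s) {c : ℝ} (hc : 0 < c) {x : E3}
    (hx : x ∈ barlowStacking c (c * Real.sqrt (2 / 3)) s) :
    (fun y : E3 => y - x) '' {y : E3 | y ∈ barlowStacking c (c * Real.sqrt (2 / 3)) s ∧ y ≠ x ∧
        dist y x ≤ 5 / 4 * c}
      = {z : E3 | x + z ∈ barlowStacking c (c * Real.sqrt (2 / 3)) s ∧ ‖z‖ = c} := by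
  ext z
  simp only [Set.mem_image, Set.mem_setOf_eq]
  constructor
  · rintro ⟨y, ⟨hy, hne, hle⟩, rfl⟩
    refine ⟨by simpa using hy, ?_⟩
    have hlt : 5 / 4 * c < Real.sqrt 2 * c := mul_lt_mul_of_pos_right five_fourths_lt_sqrt_two hc
    have h := dist_eq_of_dist_le_of_lt hs hc (ideal_sq c) hy hx hne hlt hle
    rw [← h, dist_eq_norm]
  · rintro ⟨hxz, hz⟩
    refine ⟨x + z, ⟨hxz, ?_, ?_⟩, by simp⟩
    · intro h
      have hz0 : z = 0 := by simpa using h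
      rw [hz0, norm_zero] at hz
      exact hc.ne' hz.symm
    · rw [dist_eq_norm, add_sub_cancel_left, hz]
      linarith

/-- Rescaling membership between scale `c` and Hales's scale `2`. [folklore] -/
theorem half_smul_mem_iff {c : ℝ} (hc : c ≠ 0) (y : E3) :
    (c / 2) • y ∈ barlowStacking c (c * Real.sqrt (2 / 3)) s ↔
      y ∈ barlowStacking 2 (2 * Real.sqrt (2 / 3)) s := by
  have h := smul_mem_barlowStacking_iff (t := c / 2) (a := 2) (h := 2 * Real.sqrt (2 / 3))
    (div_ne_zero hc two_ne_zero) (s := s) (x := y)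
  rwa [show c / 2 * 2 = c by ring,
    show c / 2 * (2 * Real.sqrt (2 / 3)) = c * Real.sqrt (2 / 3) by ring] at h

/-- **The recentred `5c/4`-shell of a point of the ideal stacking at scale `c` is the `c/2`-scaled
kissing shell of the corresponding point of Hales's stacking** (`c = 2`). [folklore] -/
theorem shellSet_eq_image_kissingShell (hs : IsHaggSeq s) {c : ℝ} (hc : 0 < c) (k i j : ℤ) :
    (fun y : E3 => y - barlowPos c (c * Real.sqrt (2 / 3)) s k i j) ''
        {y : E3 | y ∈ barlowStacking c (c * Real.sqrt (2 / 3)) s ∧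
          y ≠ barlowPos c (c * Real.sqrt (2 / 3)) s k i j ∧
          dist y (barlowPos c (c * Real.sqrt (2 / 3)) s k i j) ≤ 5 / 4 * c}
      = (fun z : E3 => (c / 2) • z) ''
          kissingShell (barlowStacking 2 (2 * Real.sqrt (2 / 3)) s)
            (barlowPos 2 (2 * Real.sqrt (2 / 3)) s k i j) := by
  rw [shellSet_eq hs hc (barlowPos_mem k i j)]
  have hx : barlowPos c (c * Real.sqrt (2 / 3)) s k i j =
      (c / 2) • barlowPos 2 (2 * Real.sqrt (2 / 3)) s k i j := by
    rw [smul_barlowPos]; congr 1 <;> ring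
  have hc2 : (0 : ℝ) < c / 2 := by positivity
  ext z
  simp only [Set.mem_setOf_eq, Set.mem_image, kissingShell]
  constructor
  · rintro ⟨hmem, hz⟩
    refine ⟨(2 / c) • z, ⟨?_, ?_⟩, ?_⟩
    · rw [← half_smul_mem_iff hc.ne', smul_add, smul_smul, show c / 2 * (2 / c) = 1 by field_simp,
        one_smul, ← hx]
      exact hmem
    · rw [norm_smul, Real.norm_of_nonneg (by positivity : (0:ℝ) ≤ 2 / c), hz]; field_simp
    · rw [smul_smul, show c / 2 * (2 / c) = 1 by field_simp, one_smul]
  · rintro ⟨z₂, ⟨hmem, hz₂⟩, rfl⟩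
    refine ⟨?_, ?_⟩
    · rw [hx, ← smul_add, half_smul_mem_iff hc.ne']
      exact hmem
    · rw [norm_smul, Real.norm_of_nonneg hc2.le, hz₂]; ring

/-- **Calibration.** Every point of the ideal stacking `barlowStacking c (c√(2/3)) s` (`s` Hägg,
`c > 0`) has a `5c/4`-shell EXACTLY matched, after a linear isometry, to the `c`-scaled FCC or HCP
kissing pattern. [cite: HalesDSP2012, §1.3] -/
theorem goodShell_barlowStacking (hs : IsHaggSeq s) {c : ℝ} (hc : 0 < c) {x : E3}
    (hx : x ∈ barlowStacking c (c * Real.sqrt (2 / 3)) s) :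
    ∃ T : Finset E3,
      (↑T : Set E3) = (fun y : E3 => y - x) ''
          {y : E3 | y ∈ barlowStacking c (c * Real.sqrt (2 / 3)) s ∧ y ≠ x ∧ dist y x ≤ 5 / 4 * c} ∧
      (ShellCloseTo (c / 100) T (Finset.image (fun v : E3 => c • v) fccKissingPattern) ∨
        ShellCloseTo (c / 100) T (Finset.image (fun v : E3 => c • v) hcpKissingPattern)) := by
  obtain ⟨k, i, j, rfl⟩ := hx
  have hη : (0 : ℝ) ≤ c / 100 := by positivity
  -- the shell as the rescaled kissing shell of Hales's stacking, which is an FCC or HCP pattern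
  have hshell := shellSet_eq_image_kissingShell hs hc k i j
  have key : ∀ (P : Finset E3) (A : E3 →ₗᵢ[ℝ] E3),
      kissingShell (barlowStacking 2 (2 * Real.sqrt (2 / 3)) s)
          (barlowPos 2 (2 * Real.sqrt (2 / 3)) s k i j) = (fun p => (2 : ℝ) • A p) '' (P : Set E3) →
      (↑((P.image (fun v : E3 => c • v)).image A) : Set E3) =
        (fun z : E3 => (c / 2) • z) ''
          kissingShell (barlowStacking 2 (2 * Real.sqrt (2 / 3)) s)
            (barlowPos 2 (2 * Real.sqrt (2 / 3)) s k i j) := by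
    intro P A hA
    rw [hA, Finset.coe_image, Finset.coe_image, Set.image_image, Set.image_image]
    refine Set.image_congr' fun p => ?_
    rw [map_smul, smul_smul, show c / 2 * 2 = c by ring]
  rcases hasFccOrHcpShells_barlowStacking' hs _ (barlowPos_mem k i j) with ⟨A, hA⟩ | ⟨A, hA⟩
  · refine ⟨(fccKissingPattern.image (fun v : E3 => c • v)).image A, ?_, Or.inl ⟨A, ?_⟩⟩
    · rw [hshell, key _ A hA]
    · exact EtaMatched.refl hη _
  · refine ⟨(hcpKissingPattern.image (fun v : E3 => c • v)).image A, ?_, Or.inr ⟨A, ?_⟩⟩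
    · rw [hshell, key _ A hA]
    · exact EtaMatched.refl hη _

/-- Hence ideal stackings at any scale `c ∈ [lo, hi]`, `c > 0`, satisfy the per-point hypothesis
with window `[lo, hi]`. [folklore] -/
theorem goodShellAt_barlowStacking (hs : IsHaggSeq s) {lo hi c : ℝ} (hc : 0 < c) (hlo : lo ≤ c)
    (hhi : c ≤ hi) {x : E3} (hx : x ∈ barlowStacking c (c * Real.sqrt (2 / 3)) s) :
    GoodShellAt lo hi (barlowStacking c (c * Real.sqrt (2 / 3)) s) x :=
  ⟨c, hlo, hhi, goodShell_barlowStacking hs hc hx⟩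

/-- **Non-vacuity of the crux's hypothesis**: every ideal Barlow stacking at a scale
`c ∈ [9/10, 1]` (any Hägg sequence) satisfies it. [cite: HalesDSP2012, §1.3] -/
theorem hypothesis_barlowStacking (hs : IsHaggSeq s) {c : ℝ} (h9 : 9 / 10 ≤ c) (h1 : c ≤ 1) :
    (barlowStacking c (c * Real.sqrt (2 / 3)) s).Nonempty ∧
      ∀ x ∈ barlowStacking c (c * Real.sqrt (2 / 3)) s,
        GoodShellAt (9 / 10) 1 (barlowStacking c (c * Real.sqrt (2 / 3)) s) x :=
  ⟨⟨_, barlowPos_mem 0 0 0⟩, fun _ hx => goodShellAt_barlowStacking hs (by linarith) h9 h1 hx⟩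

end Calibration


end Summit.AtomisticToContinuum.Crystallization.Theorems.ShellsToBarlowChartNegative
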